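import Literature.NumberTheory.Automorphic.LieAlgebraGLStabilizer
import HarnessLib

/-!
# `Lie(H)` is infinitesimally orthogonal for every bilinear form `H` preserves: `ᵗg S g = S` on `H` ⇒ `ᵗA S + S A = 0` on `Lie(H)`
(Springer, *Linear Algebraic Groups*, 7.4.7 (3)(b): «The Lie algebra `𝔤` is the set of all `t ∈ End(V)` such that
`(tv, w) + (v, tw) = 0` […] (Hint: First show that `𝔤` is contained in the set of these `t`)» — the CONTAINMENT, for an
ARBITRARY matrix `S` and any subgroup of the isometry group)

Concrete `k`-points vocabulary of `Literature/NumberTheory/Automorphic` (`H ≤ GL n k`, `lieAlgebraGL H ⊆ Matrix n n k` cut out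
by the differentials `tangentDeriv p` at `1` of the vanishing ideal of `H`). For a fixed matrix `S` (the Gram matrix of any
bilinear form — symmetric, alternating or neither):
* `aeval_formRel` — the `(i, j)` entry of `ᵗg S g − S` is the value at `g` of the coordinate polynomial
  `Σ_{a,b} S_{ab} x_{ai} x_{bj} − S_{ij}` (written out inline; no definition);
* `tangentDeriv_formRel` — its differential at `1` along `A` is `(ᵗA S + S A)_{ij}`;
* **`transpose_mul_add_mul_eq_zero_of_mem_lieAlgebraGL`** — if `ᵗg S g = S` for all `g ∈ H` then `ᵗA S + S A = 0` for
  all `A ∈ Lie(H)` (the tree's `ComplexTorusSymplecticGroupLieAlgebra.transpose_mul_J_add_J_mul_eq_zero_of_mem_lieAlgebraGL`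
  is the case `S = J`, `H = Sp_{2l}(ℂ)`).
THEOREMS only (no definition), any field. Written for the Hodge cell's crux K1Q (BQ-CORE: the Lie algebra of the Zariski closure of a
monodromy group preserving the intersection form is skew for it). [cite: SpringerLAG1998, 7.4.7 (3)(b)]
-/

noncomputable section

open scoped MatrixGroups
open Matrix MvPolynomial

namespace Literature.NumberTheory.Automorphic

variable {k : Type*} [Field k] {n : Type*} [Fintype n] [DecidableEq n]

/-- The `(i, j)` entry of `ᵗg S g − S` is the value at `g` of the coordinate polynomial `Σ_{a,b} S_{ab} x_{ai} x_{bj} − S_{ij}`.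
[cite: SpringerLAG1998, 7.4.7 (3)(b)] -/
theorem aeval_formRel (S : Matrix n n k) (g : GL n k) (i j : n) :
    MvPolynomial.aeval (glCoordFun g) (∑ a, ∑ b, C (S a b) * X (Sum.inl (a, i)) * X (Sum.inl (b, j)) - C (S i j) : MvPolynomial (GLCoord n) k) =
      ((g : Matrix n n k)ᵀ * S * (g : Matrix n n k) - S) i j := by
  simp only [map_sub, map_sum, map_mul, MvPolynomial.aeval_C, MvPolynomial.aeval_X, glCoordFun_inl,
    Matrix.sub_apply, Matrix.mul_apply, Matrix.transpose_apply, Finset.sum_mul]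
  congr 1
  rw [Finset.sum_comm]
  refine Finset.sum_congr rfl fun b _ ↦ Finset.sum_congr rfl fun a _ ↦ ?_
  change S a b * _ * _ = _
  ring

/-- The relations `Σ_{a,b} S_{ab} x_{ai} x_{bj} − S_{ij}` vanish on a subgroup preserving `S`. [cite: SpringerLAG1998, 7.4.7 (3)(b)] -/
theorem formRel_mem_vanishingIdeal {H : Subgroup (GL n k)} {S : Matrix n n k}
    (hH : ∀ g ∈ H, (g : Matrix n n k)ᵀ * S * (g : Matrix n n k) = S) (i j : n) :
    (∑ a, ∑ b, C (S a b) * X (Sum.inl (a, i)) * X (Sum.inl (b, j)) - C (S i j) : MvPolynomial (GLCoord n) k) ∈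
      MvPolynomial.vanishingIdeal k (glCoordFun '' (H : Set (GL n k))) := by
  rw [MvPolynomial.mem_vanishingIdeal_iff]
  rintro _ ⟨g, hg, rfl⟩
  rw [aeval_formRel, hH g hg, sub_self, Matrix.zero_apply]

/-- The differential at `1` of `Σ_{a,b} S_{ab} x_{ai} x_{bj} − S_{ij}` along `A` is `(ᵗA S + S A)_{ij}`. [cite: SpringerLAG1998, 7.4.7 (3)(b)] -/
theorem tangentDeriv_formRel (S A : Matrix n n k) (i j : n) :
    tangentDeriv (∑ a, ∑ b, C (S a b) * X (Sum.inl (a, i)) * X (Sum.inl (b, j)) - C (S i j) : MvPolynomial (GLCoord n) k) A =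
      (Aᵀ * S + S * A) i j := by
  rw [tangentDeriv_sub, tangentDeriv_C, sub_zero, tangentDeriv_sum]
  simp_rw [tangentDeriv_sum, tangentDeriv_mul_X, tangentDeriv_C, map_mul, MvPolynomial.eval_C,
    MvPolynomial.eval_X, glCoordFun_inl, Units.val_one, zero_mul, add_zero]
  simp only [tangentCoord, Sum.elim_inl, Finset.sum_add_distrib]
  have hS1 : ∑ a, ∑ b, S a b * (1 : Matrix n n k) a i * A b j = ∑ b, S i b * A b j := by
    rw [Finset.sum_eq_single i (fun a _ ha ↦ by simp [Matrix.one_apply_ne ha]) fun h ↦ absurd (Finset.mem_univ i) h]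
    simp [Matrix.one_apply_eq]
  have hS2 : ∑ a, ∑ b, S a b * A a i * (1 : Matrix n n k) b j = ∑ a, A a i * S a j :=
    Finset.sum_congr rfl fun a _ ↦ by
      rw [Finset.sum_eq_single j (fun b _ hb ↦ by simp [Matrix.one_apply_ne hb]) fun h ↦ absurd (Finset.mem_univ j) h]
      rw [Matrix.one_apply_eq, mul_one, mul_comm]
  rw [hS1, hS2, add_comm, Matrix.add_apply, Matrix.mul_apply, Matrix.mul_apply]
  rfl

/-- **`Lie(H)` is skew for every bilinear form `H` preserves** (Springer 7.4.7 (3)(b), the containment «`𝔤` is contained in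
the set of these `t`»): if `ᵗg S g = S` for all `g ∈ H ≤ GL n k`, then `ᵗA S + S A = 0` for all `A ∈ Lie(H)`.
[cite: SpringerLAG1998, 7.4.7 (3)(b)] -/
theorem transpose_mul_add_mul_eq_zero_of_mem_lieAlgebraGL {H : Subgroup (GL n k)} {S : Matrix n n k}
    (hH : ∀ g ∈ H, (g : Matrix n n k)ᵀ * S * (g : Matrix n n k) = S) {A : Matrix n n k} (hA : A ∈ lieAlgebraGL H) :
    Aᵀ * S + S * A = 0 := by
  ext i j
  have h := (mem_lieAlgebraGL_iff.1 hA) _ (formRel_mem_vanishingIdeal hH i j)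
  rwa [tangentDeriv_formRel] at h

end Literature.NumberTheory.Automorphic

end
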